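import Literature.NumberTheory.Transcendental.NesterenkoElimIdealPrime
import HarnessLib

/-!
# Nesterenko's elimination-theoretic invariants over an arbitrary field (LNM 1752 Ch. 3 §4, Def. 4.3–4.5)

`Literature/NumberTheory/Transcendental/NesterenkoEliminationK.lean` — definitions (generic field)
with `rfl` bridges to the case `K = ℚ` of `NesterenkoElimination.lean`.

Chapter 3 §4 of the book develops the associated (Chow) form `F` of a homogeneous unmixed ideal
`I ⊂ K[x₀, …, x_m]`, its degree `deg I` and height `h(I)` for an ARBITRARY field `K` equipped
with a family of absolute values ("Let `K` be a field of characteristic zero …", p. 37), and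
Chapter 10 (the multiplicity estimate behind Nesterenko's theorem on `q, P(q), Q(q), R(q)`) runs
this theory over `K = ℂ(z)` (p. 153: "The field `K` is in our case the field of rational functions
`ℂ(z)`"; §4 of Ch. 10 invokes Prop. 4.7 and Prop. 4.11 of Ch. 3 over `ℂ(z)`, Prop. 3.6 invokes
Prop. 4.4/4.7). The tree's development `Nesterenko.*` (`NesterenkoElimination*.lean`) is the case
`K = ℚ` (`Rx m = ℚ[x̲]`). `NesterenkoElimIdealPrime.lean` already re-issued Definition 4.3
(`NesterenkoK.linForm`, `NesterenkoK.extIdeal`, `NesterenkoK.elimIdeal`) over any field, with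
`rfl` bridges. This file completes the PURELY ALGEBRAIC vocabulary of §4 over any field `K`:

* `NesterenkoK.chowForm I r` — the associated form: a generator of `Ī(r) ⊂ K[U]` when this ideal is
  principal (Prop. 4.4), junk `0` otherwise; `NesterenkoK.span_chowForm`;
* `NesterenkoK.blockDeg F i` — `deg_{uᵢ} F`; `NesterenkoK.ideg I r` — `deg I := deg_{u₁} F`
  (Def. 4.5);
* `NesterenkoK.IsUnmixedOfRank I r` — "`I` unmixed, `dim I = r − 1`" (footnote 5, p. 38), for an
  ideal of any commutative ring (every associated prime `𝔭` has `dim R/𝔭 = r`);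
* `NesterenkoK.primaryExponent Q` — the exponent of a primary ideal (least `k` with `(√Q)ᵏ ⊆ Q`),
  for an ideal of any commutative ring.

For `K = ℚ` each of these is DEFINITIONALLY the object of `NesterenkoElimination.lean`
(`Nesterenko.chowForm_eq`, `Nesterenko.blockDeg_eq`, `Nesterenko.ideg_eq`,
`Nesterenko.isUnmixedOfRank_iff`, `Nesterenko.primaryExponent_eq` — all `rfl`/`Iff.rfl`), so every
`ℚ`-statement of the tree is literally an instance of the generic one. The heights `h`, the values
`|I(ω̄)|`, `‖P‖_ω̄` and `ρ` depend on the chosen absolute values (archimedean + `p`-adic for `ℚ`,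
Ch. 3; `|α| = e^{−ord_{z=0} α}` and the degree places for `ℂ(z)`, Ch. 3 Example 1 and Ch. 10 §2)
and are not re-issued here.

Proved API: `span_chowForm`, `chowForm_mem`, `chowForm_ne_zero_iff`,
`radical_pow_primaryExponent_le` (Noetherian rings), `primaryExponent_pos`, `primaryExponent_le`,
`primaryExponent_eq_one_of_isPrime`, `isUnmixedOfRank_of_isPrime`, `IsUnmixedOfRank.ne_top`,
`sum_le_blockDeg`, `ideg_of_pos`.

## References

* [NesterenkoPhilippon2001] Yu. V. Nesterenko, P. Philippon (eds.), *Introduction to Algebraic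
  Independence Theory*, LNM 1752, Springer 2001, Ch. 3 §4: Def. 4.3, Prop. 4.4, Def. 4.5 and
  footnote 5 (p. 38); Ch. 10 §2 (p. 153), §3 Prop. 3.6 (pp. 157–160), §4 (pp. 161–162).
* [Nes10] Yu. V. Nesterenko, Proc. Steklov Inst. Math. 218 (1997) 294–331, §1.
-/

noncomputable section

open MvPolynomial

namespace Literature.NumberTheory.Transcendental

namespace NesterenkoK

/-! ### The exponent of a (primary) ideal and unmixedness, for any commutative ring -/

section Ring

variable {R : Type*} [CommRing R]

/-- The **exponent** of a (primary) ideal `Q` of a commutative ring: the least `k` with `(√Q)ᵏ ⊆ Q`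
(`0`, junk, if there is none). For `R = ℚ[x̲]` this is `Nesterenko.primaryExponent`
(`Nesterenko.primaryExponent_eq`).
[cite: NesterenkoPhilippon2001, Ch. 3 Prop. 4.4 (p. 38); Ch. 10 §4 (p. 161)] -/
def primaryExponent (Q : Ideal R) : ℕ :=
  sInf {k : ℕ | Q.radical ^ k ≤ Q}

/-- In a Noetherian ring the exponent does its job: `(√Q)^k ⊆ Q` for `k = primaryExponent Q`.
[folklore] -/
theorem radical_pow_primaryExponent_le [IsNoetherianRing R] (Q : Ideal R) :
    Q.radical ^ primaryExponent Q ≤ Q := by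
  obtain ⟨k, hk⟩ := Ideal.exists_radical_pow_le_of_fg Q (IsNoetherian.noetherian _)
  exact Nat.sInf_mem (s := {k : ℕ | Q.radical ^ k ≤ Q}) ⟨k, hk⟩

/-- The exponent of a proper ideal of a Noetherian ring is positive (`(√Q)⁰ = R ⊄ Q`). [folklore] -/
theorem primaryExponent_pos [IsNoetherianRing R] {Q : Ideal R} (hQ : Q ≠ ⊤) :
    0 < primaryExponent Q := by
  by_contra h
  have h0 : primaryExponent Q = 0 := by omega
  have := radical_pow_primaryExponent_le Q
  rw [h0, pow_zero, Ideal.one_eq_top, top_le_iff] at this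
  exact hQ this

/-- `primaryExponent Q ≤ k` as soon as `(√Q)ᵏ ⊆ Q`. [folklore] -/
theorem primaryExponent_le {Q : Ideal R} {k : ℕ} (hk : Q.radical ^ k ≤ Q) :
    primaryExponent Q ≤ k :=
  Nat.sInf_le hk

/-- A prime ideal has exponent `1`. [folklore] -/
theorem primaryExponent_eq_one_of_isPrime {𝔭 : Ideal R} (h𝔭 : 𝔭.IsPrime) :
    primaryExponent 𝔭 = 1 := by
  apply le_antisymm
  · exact primaryExponent_le (by rw [h𝔭.radical, pow_one])
  · by_contra h
    have h0 : primaryExponent 𝔭 = 0 := by omega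
    have hne : {k : ℕ | 𝔭.radical ^ k ≤ 𝔭}.Nonempty := ⟨1, by simp [h𝔭.radical]⟩
    have hmem := Nat.sInf_mem hne
    change 𝔭.radical ^ primaryExponent 𝔭 ≤ 𝔭 at hmem
    rw [h0, pow_zero, Ideal.one_eq_top, top_le_iff] at hmem
    exact h𝔭.ne_top hmem

/-- "`I` is an unmixed ideal with `dim I = r − 1`": `I` is proper and every associated prime `𝔭`
of `I` has `dim R/𝔭 = r` (Krull), i.e. projective dimension `r − 1` when `R = K[x₀, …, x_m]`.
For `R = ℚ[x̲]` this is `Nesterenko.IsUnmixedOfRank` (`Nesterenko.isUnmixedOfRank_iff`).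
[cite: NesterenkoPhilippon2001, Ch. 3 §4 footnote 5 (p. 38)] -/
def IsUnmixedOfRank (I : Ideal R) (r : ℕ) : Prop :=
  I ≠ ⊤ ∧ ∀ 𝔭 ∈ I.associatedPrimes, ringKrullDim (R ⧸ 𝔭) = r

/-- An unmixed ideal is proper. [folklore] -/
theorem IsUnmixedOfRank.ne_top {I : Ideal R} {r : ℕ} (h : IsUnmixedOfRank I r) : I ≠ ⊤ := h.1

/-- Every associated prime `𝔭` of an unmixed ideal of rank `r` has `dim R/𝔭 = r`. [folklore] -/
theorem IsUnmixedOfRank.ringKrullDim_eq {I : Ideal R} {r : ℕ} (h : IsUnmixedOfRank I r)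
    {𝔭 : Ideal R} (h𝔭 : 𝔭 ∈ I.associatedPrimes) : ringKrullDim (R ⧸ 𝔭) = r :=
  h.2 𝔭 h𝔭

/-- A prime ideal `𝔭` with `dim R/𝔭 = r` is unmixed of that dimension: its only associated prime is
`𝔭` itself. [folklore] -/
theorem isUnmixedOfRank_of_isPrime {𝔭 : Ideal R} (h𝔭 : 𝔭.IsPrime) {r : ℕ}
    (hr : ringKrullDim (R ⧸ 𝔭) = r) : IsUnmixedOfRank 𝔭 r := by
  refine ⟨h𝔭.ne_top, fun P hP => ?_⟩
  obtain ⟨hPprime, x, hx⟩ := (Submodule.isAssociatedPrime_def.mp hP)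
  suffices P = 𝔭 by rw [this, hr]
  by_cases hxp : x ∈ 𝔭
  · have htop : Submodule.colon 𝔭 {x} = ⊤ := by
      rw [eq_top_iff]
      intro a _
      exact Submodule.mem_colon_singleton.mpr (by simpa using 𝔭.mul_mem_left a hxp)
    rw [htop, Ideal.radical_top] at hx
    exact absurd hx hPprime.ne_top
  · have hcol : Submodule.colon 𝔭 {x} = 𝔭 := by
      ext a
      rw [Submodule.mem_colon_singleton, smul_eq_mul]
      exact ⟨fun h => (h𝔭.mem_or_mem h).resolve_right hxp, fun h => 𝔭.mul_mem_right x h⟩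
    rw [hx, hcol, h𝔭.radical]

end Ring

/-! ### The associated form and the degree of an ideal over any field (Prop. 4.4, Def. 4.5) -/

section FieldK

variable {K : Type*} [Field K] {m : ℕ}

/-- The **associated (Chow, Cayley) form** `F ∈ K[U]` of `I ⊂ K[x̲]` of index `r`: a generator of
the ideal `Ī(r)` of `K[U]` when this ideal is principal (Prop. 4.4: it is, for `I` homogeneous
unmixed with `dim I = r − 1`), and the junk value `0` otherwise; unique up to a factor in `Kˣ`.
For `K = ℚ` this is `Nesterenko.chowForm` (`Nesterenko.chowForm_eq`).
[cite: NesterenkoPhilippon2001, Ch. 3 Prop. 4.4 and the paragraph after it (p. 38)] -/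
def chowForm (I : Ideal (MvPolynomial (Fin (m + 1)) K)) (r : ℕ) :
    MvPolynomial (Fin r × Fin (m + 1)) K :=
  open Classical in
  if h : (elimIdeal I r).IsPrincipal then
    (haveI := h; Submodule.IsPrincipal.generator (elimIdeal I r))
  else 0

/-- When `Ī(r)` is principal, `chowForm I r` generates it. [folklore] -/
theorem span_chowForm (I : Ideal (MvPolynomial (Fin (m + 1)) K)) (r : ℕ)
    (h : (elimIdeal I r).IsPrincipal) :
    Ideal.span {chowForm I r} = elimIdeal I r := by
  rw [chowForm, dif_pos h]
  haveI := h
  exact Ideal.span_singleton_generator _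

/-- `chowForm I r ∈ Ī(r)` always (trivially so in the junk case). [folklore] -/
theorem chowForm_mem (I : Ideal (MvPolynomial (Fin (m + 1)) K)) (r : ℕ) :
    chowForm I r ∈ elimIdeal I r := by
  by_cases h : (elimIdeal I r).IsPrincipal
  · rw [← span_chowForm I r h]
    exact Ideal.mem_span_singleton_self _
  · rw [chowForm, dif_neg h]
    exact zero_mem _

/-- When `Ī(r)` is principal: `chowForm I r ≠ 0 ↔ Ī(r) ≠ 0`. [folklore] -/
theorem chowForm_ne_zero_iff (I : Ideal (MvPolynomial (Fin (m + 1)) K)) (r : ℕ)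
    (h : (elimIdeal I r).IsPrincipal) :
    chowForm I r ≠ 0 ↔ elimIdeal I r ≠ ⊥ := by
  rw [← span_chowForm I r h, Ne, Ne, Ideal.span_singleton_eq_bot]

/-- The degree of `F ∈ K[U]` in the group of variables `uᵢ = (u_{i0}, …, u_{im})` ("`deg_{uᵢ} F`").
For `K = ℚ` this is `Nesterenko.blockDeg` (`Nesterenko.blockDeg_eq`).
[cite: NesterenkoPhilippon2001, Ch. 3 Def. 4.5 (p. 38)] -/
def blockDeg {r : ℕ} (F : MvPolynomial (Fin r × Fin (m + 1)) K) (i : Fin r) : ℕ :=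
  F.support.sup fun e => ∑ j : Fin (m + 1), e (i, j)

/-- `deg_{uᵢ} 0 = 0`. [folklore] -/
@[simp] theorem blockDeg_zero {r : ℕ} (i : Fin r) :
    blockDeg (0 : MvPolynomial (Fin r × Fin (m + 1)) K) i = 0 := by
  simp [blockDeg]

/-- Every monomial of `F` has `uᵢ`-degree at most `blockDeg F i`. [folklore] -/
theorem sum_le_blockDeg {r : ℕ} {F : MvPolynomial (Fin r × Fin (m + 1)) K}
    {e : Fin r × Fin (m + 1) →₀ ℕ} (he : e ∈ F.support) (i : Fin r) :
    ∑ j : Fin (m + 1), e (i, j) ≤ blockDeg F i :=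
  Finset.le_sup (f := fun e : Fin r × Fin (m + 1) →₀ ℕ => ∑ j : Fin (m + 1), e (i, j)) he

/-- **Definition 4.5**: `deg I = deg_{u₁} F`, `F` the associated form of index `r` (`= dim I + 1`;
for `r = 0` the junk value `0`). For `K = ℚ` this is `Nesterenko.ideg` (`Nesterenko.ideg_eq`).
[cite: NesterenkoPhilippon2001, Ch. 3 Def. 4.5 (p. 38)] -/
def ideg (I : Ideal (MvPolynomial (Fin (m + 1)) K)) (r : ℕ) : ℕ :=
  if h : 0 < r then blockDeg (chowForm I r) ⟨0, h⟩ else 0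

/-- For `r ≥ 1`, `deg I = deg_{u₁} F`. [cite: NesterenkoPhilippon2001, Ch. 3 Def. 4.5 (p. 38)] -/
theorem ideg_of_pos (I : Ideal (MvPolynomial (Fin (m + 1)) K)) {r : ℕ} (hr : 0 < r) :
    ideg I r = blockDeg (chowForm I r) ⟨0, hr⟩ := by
  rw [ideg, dif_pos hr]

end FieldK

end NesterenkoK

/-! ### The case `K = ℚ`: agreement with `NesterenkoElimination.lean` -/

namespace Nesterenko

variable {m : ℕ}

/-- `Nesterenko.chowForm` is the case `K = ℚ` of `NesterenkoK.chowForm`. [folklore] -/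
theorem chowForm_eq (I : Ideal (Rx m)) (r : ℕ) : chowForm I r = NesterenkoK.chowForm I r := rfl

/-- `Nesterenko.blockDeg` is the case `K = ℚ` of `NesterenkoK.blockDeg`. [folklore] -/
theorem blockDeg_eq {r : ℕ} (F : RU r m) (i : Fin r) : blockDeg F i = NesterenkoK.blockDeg F i :=
  rfl

/-- `Nesterenko.ideg` is the case `K = ℚ` of `NesterenkoK.ideg`. [folklore] -/
theorem ideg_eq (I : Ideal (Rx m)) (r : ℕ) : ideg I r = NesterenkoK.ideg I r := rfl

/-- `Nesterenko.IsUnmixedOfRank` is the case `K = ℚ` of `NesterenkoK.IsUnmixedOfRank`. [folklore] -/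
theorem isUnmixedOfRank_iff (I : Ideal (Rx m)) (r : ℕ) :
    IsUnmixedOfRank I r ↔ NesterenkoK.IsUnmixedOfRank I r := Iff.rfl

/-- `Nesterenko.primaryExponent` is the case `K = ℚ` of `NesterenkoK.primaryExponent`. [folklore] -/
theorem primaryExponent_eq (Q : Ideal (Rx m)) : primaryExponent Q = NesterenkoK.primaryExponent Q :=
  rfl

end Nesterenko

end Literature.NumberTheory.Transcendental

end
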